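import Literature.Algebra.Homology.ExtDualityPairing
import Mathlib.Algebra.Homology.DerivedCategory.Ext.ExactSequences
import Mathlib.Algebra.FiveLemma
import Mathlib.Algebra.Module.Injective
import HarnessLib

/-!
# The five-lemma ladder of Tate's duality theorem (Milne ADT I (1.9.1) / Harari Thm. 16.21), formal part

Topic `Algebra/Homology`; namespace `Literature.Algebra.Homology.ExtDuality`.  Theorems only (pure
homological algebra for Mathlib's `Abelian.Ext` in any abelian category with `HasExt`); no definition,
no named fact, no instance, no `sorry`.  Sequel of `ExtDualityPairing` (the Yoneda duality pairing
`⟨x, y⟩ = inv (y ∘ x)`, Harari's `α^r(M) = adjointMap inv M`, its naturality and δ-compatibility).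

THE STATEMENT IN PRINT.  Milne, *Arithmetic Duality Theorems* I, proof of Thm. 1.8 (p. 22, diagram
(1.9.1)); Harari, *Galois Cohomology and Class Field Theory*, Lemma 16.19 – Thm. 16.21: for a short
exact sequence `0 → M → M_* → M₁ → 0` the maps `α^r` form a commutative ladder between the long exact
`Ext(–, C)`-sequence and the `Q`-dual of the long exact `Ext(P, –)`-sequence (`Q = ℚ/ℤ` injective),
and the four lemma transfers injectivity / surjectivity of `α` along the ladder.  Here, for a short
exact `S : 0 → X₁ → X₂ → X₃ → 0` (`X₁ = M`, `X₂ = M_*`, `X₃ = M₁`), an additive `inv : Ext²(P, C) →+ Q`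
with `Q` an injective (Baer) `ℤ`-module, and bidegrees `s + r = 2`, `r' = r + 1`, `s' + 1 = s`:

* `exact_compHom'_of_baer`: the `Q`-dual of an exact pair `A → B → D` is exact (Baer's criterion);
* the rows: `exact_precomp_g_f`, `exact_precomp_f_extClass`, `exact_precomp_extClass_g`
  (Mathlib's contravariant `Ext` sequence as `Function.Exact`), and the duals `exact_dual_…` of the
  covariant sequence; the squares `compHom'_comp_adjointMap_g/_f/_extClass`;
* **`adjointInjective_of_ladder`** (Milne: `α^r(G,M)` injective ⟸ `α^r(G,M₁)` surjective,
  `α^r(U,M) = α^r(M_*)` injective, `α^{r+1}(G,M₁)` injective);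
* **`adjointSurjective_of_ladder`** (`α^r(M)` surjective ⟸ `α^r(M_*)` surjective, `α^{r+1}(M₁)`
  surjective, `α^{r+1}(M_*)` injective);
* the edge `r = 2` (the dual row continues with zeros): `adjointInjective_two_of_ladder`
  (⟸ `α²(M₁)` surjective, `α²(M_*)` injective, `Ext³(M₁, C) = 0`), `adjointSurjective_two_of_ladder`
  (⟸ `α²(M_*)` surjective — nothing else);
* the rows `r ≥ 3` where "`α^r` bijective" means `Extʳ(–, C) = 0`: `ext_eq_zero_of_ladder₁/₃`.

Written for Route A of the Poitou–Tate programme of crux `stmt-BirchSwinnertonDyer-19295` (cell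
`bsd-schneider-ideate`, seat door-c4 gen 15): the induction of Milne I Thm. 1.8 / Harari 16.21 for
the class formation `(Γ_K, C̄)` runs on these lemmas once the columns `α^r(U, M)` (Shapiro) and
Lemma 1.9 are supplied.  HONEST FRAMING: homological algebra only; no arithmetic statement here.

## References
* J. S. Milne, *Arithmetic Duality Theorems* (2nd ed. 2006), I §1, Theorem 1.8 and its proof,
  diagram (1.9.1) (pp. 21–23). [MilneADT2006]
* D. Harari, *Galois Cohomology and Class Field Theory*, Universitext (2020), §16.3, Lemma 16.19 –
  Theorem 16.21 (pp. 274–276). [Harari2020]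
-/

noncomputable section

universe w' w v u

namespace Literature.Algebra.Homology

namespace ExtDuality

open CategoryTheory CategoryTheory.Abelian

/-! ## §0 The `Q`-dual of an exact pair is exact (`Q` injective) -/

section Dual

variable {Q : Type w'} [AddCommGroup Q]

/-- `compHom' u φ = φ ∘ u` (Mathlib's precomposition as an additive map). [cite: Harari2020, §16.3] -/
theorem compHom'_apply_eq {A B : Type*} [AddCommGroup A] [AddCommGroup B] (u : A →+ B) (φ : B →+ Q) :
    AddMonoidHom.compHom' u φ = φ.comp u := rfl

/-- **The `Q`-dual of an exact pair is exact** for `Q` an injective `ℤ`-module (Baer): if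
`A —f→ B —g→ D` is exact at `B`, then `Hom(D, Q) —g^*→ Hom(B, Q) —f^*→ Hom(A, Q)` is exact at
`Hom(B, Q)`. [cite: Harari2020, §16.3 (proof of Lemma 16.19)] -/
theorem exact_compHom'_of_baer (hQ : Module.Baer ℤ Q) {A B D : Type*} [AddCommGroup A]
    [AddCommGroup B] [AddCommGroup D] (f : A →+ B) (g : B →+ D) (hfg : Function.Exact f g) :
    Function.Exact (AddMonoidHom.compHom' (P := Q) g) (AddMonoidHom.compHom' (P := Q) f) := by
  intro ψ
  constructor
  · intro hψ
    change ψ.comp f = 0 at hψ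
    have hsurj : Function.Surjective g.rangeRestrict := AddMonoidHom.rangeRestrict_surjective g
    have hker : g.rangeRestrict.ker ≤ ψ.ker := by
      intro b hb
      have hb' : g b = 0 := by
        have h1 : ((g.rangeRestrict b : g.range) : D) = 0 := by
          rw [(AddMonoidHom.mem_ker).1 hb]
          rfl
        rwa [AddMonoidHom.coe_rangeRestrict] at h1
      obtain ⟨a, rfl⟩ := (hfg b).1 hb'
      exact (AddMonoidHom.mem_ker).2 (DFunLike.congr_fun hψ a)
    obtain ⟨φ, hφ⟩ := hQ.extension_property_addMonoidHom g.range.subtype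
      (fun x y hxy => Subtype.ext hxy) (g.rangeRestrict.liftOfSurjective hsurj ⟨ψ, hker⟩)
    refine ⟨φ, ?_⟩
    change φ.comp g = ψ
    ext b
    have h1 : φ (g.range.subtype (g.rangeRestrict b)) =
        (g.rangeRestrict.liftOfSurjective hsurj ⟨ψ, hker⟩) (g.rangeRestrict b) :=
      DFunLike.congr_fun hφ (g.rangeRestrict b)
    rw [AddMonoidHom.liftOfSurjective, AddMonoidHom.liftOfRightInverse_comp_apply] at h1
    exact h1
  · rintro ⟨φ, rfl⟩
    change (φ.comp g).comp f = 0
    ext a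
    change φ (g (f a)) = 0
    rw [hfg.apply_apply_eq_zero, map_zero]

/-- Degenerate case: the `Q`-dual of an injective map is surjective.
[cite: Harari2020, §16.3 (proof of Lemma 16.19)] -/
theorem compHom'_surjective_of_injective_of_baer (hQ : Module.Baer ℤ Q) {A B : Type*} [AddCommGroup A]
    [AddCommGroup B] (f : A →+ B) (hf : Function.Injective f) :
    Function.Surjective (AddMonoidHom.compHom' (P := Q) f) := fun ψ =>
  hQ.extension_property_addMonoidHom f hf ψ

end Dual

/-! ## §1 The rows of the ladder as `Function.Exact` statements -/

section Rows

variable {𝒞 : Type u} [Category.{v} 𝒞] [Abelian 𝒞] [HasExt.{w} 𝒞]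
  {S : ShortComplex 𝒞} (hS : S.ShortExact)

include hS

/-- Top row, exactness at `Extʳ(X₂, C)`: `Extʳ(X₃, C) —g^*→ Extʳ(X₂, C) —f^*→ Extʳ(X₁, C)`.
[cite: MilneADT2006, I (1.9.1)] -/
theorem exact_precomp_g_f (C : 𝒞) (r : ℕ) :
    Function.Exact ((Ext.mk₀ S.g).precomp C (zero_add r)) ((Ext.mk₀ S.f).precomp C (zero_add r)) := by
  intro x
  constructor
  · intro hx
    exact Ext.contravariant_sequence_exact₂ (hS := hS) (Y := C) x hx
  · rintro ⟨x₃, rfl⟩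
    change (Ext.mk₀ S.f).comp ((Ext.mk₀ S.g).comp x₃ (zero_add r)) (zero_add r) = 0
    rw [← Ext.comp_assoc_of_second_deg_zero, Ext.mk₀_comp_mk₀, S.zero, Ext.mk₀_zero, Ext.zero_comp]

/-- Top row, exactness at `Extʳ(X₁, C)`: `Extʳ(X₂, C) —f^*→ Extʳ(X₁, C) —δ→ Extʳ⁺¹(X₃, C)`.
[cite: MilneADT2006, I (1.9.1)] -/
theorem exact_precomp_f_extClass (C : 𝒞) {r r' : ℕ} (hr : 1 + r = r') :
    Function.Exact ((Ext.mk₀ S.f).precomp C (zero_add r)) (hS.extClass.precomp C hr) := by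
  intro x
  constructor
  · intro hx
    exact Ext.contravariant_sequence_exact₁ (hS := hS) (Y := C) x hr hx
  · rintro ⟨x₂, rfl⟩
    exact hS.extClass_comp_assoc x₂ (h := hr)

/-- Top row, exactness at `Extʳ⁺¹(X₃, C)`: `Extʳ(X₁, C) —δ→ Extʳ⁺¹(X₃, C) —g^*→ Extʳ⁺¹(X₂, C)`.
[cite: MilneADT2006, I (1.9.1)] -/
theorem exact_precomp_extClass_g (C : 𝒞) {r r' : ℕ} (hr : 1 + r = r') :
    Function.Exact (hS.extClass.precomp C hr) ((Ext.mk₀ S.g).precomp C (zero_add r')) := by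
  intro x
  constructor
  · intro hx
    exact Ext.contravariant_sequence_exact₃ (hS := hS) (Y := C) x hx hr
  · rintro ⟨x₁, rfl⟩
    exact hS.comp_extClass_assoc x₁ hr

/-- Covariant sequence, exactness at `Extˢ(P, X₂)`: `Extˢ(P, X₁) —f_*→ Extˢ(P, X₂) —g_*→ Extˢ(P, X₃)`.
[cite: MilneADT2006, I (1.9.1)] -/
theorem exact_postcomp_f_g (P : 𝒞) (s : ℕ) :
    Function.Exact ((Ext.mk₀ S.f).postcomp P (add_zero s)) ((Ext.mk₀ S.g).postcomp P (add_zero s)) := by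
  intro y
  constructor
  · intro hy
    exact Ext.covariant_sequence_exact₂ (hS := hS) (X := P) y hy
  · rintro ⟨y₁, rfl⟩
    change (y₁.comp (Ext.mk₀ S.f) (add_zero s)).comp (Ext.mk₀ S.g) (add_zero s) = 0
    rw [Ext.comp_assoc_of_third_deg_zero, Ext.mk₀_comp_mk₀, S.zero, Ext.mk₀_zero, Ext.comp_zero]

/-- Covariant sequence, exactness at `Extˢ(P, X₁)`: `Extˢ'(P, X₃) —δ→ Extˢ(P, X₁) —f_*→ Extˢ(P, X₂)`
(`s' + 1 = s`). [cite: MilneADT2006, I (1.9.1)] -/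
theorem exact_postcomp_extClass_f (P : 𝒞) {s' s : ℕ} (hs : s' + 1 = s) :
    Function.Exact (hS.extClass.postcomp P hs) ((Ext.mk₀ S.f).postcomp P (add_zero s)) := by
  intro y
  constructor
  · intro hy
    exact Ext.covariant_sequence_exact₁ (hS := hS) (X := P) y hy hs
  · rintro ⟨y₃, rfl⟩
    change (y₃.comp hS.extClass hs).comp (Ext.mk₀ S.f) (add_zero s) = 0
    rw [Ext.comp_assoc_of_third_deg_zero, hS.extClass_comp, Ext.comp_zero]

/-- Covariant sequence, exactness at `Extˢ'(P, X₃)`: `Extˢ'(P, X₂) —g_*→ Extˢ'(P, X₃) —δ→ Extˢ(P, X₁)`.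
[cite: MilneADT2006, I (1.9.1)] -/
theorem exact_postcomp_g_extClass (P : 𝒞) {s' s : ℕ} (hs : s' + 1 = s) :
    Function.Exact ((Ext.mk₀ S.g).postcomp P (add_zero s')) (hS.extClass.postcomp P hs) := by
  intro y
  constructor
  · intro hy
    exact Ext.covariant_sequence_exact₃ (hS := hS) (X := P) y hs hy
  · rintro ⟨y₂, rfl⟩
    change (y₂.comp (Ext.mk₀ S.g) (add_zero s')).comp hS.extClass hs = 0
    rw [Ext.comp_assoc_of_second_deg_zero, hS.comp_extClass, Ext.comp_zero]

variable {Q : Type w'} [AddCommGroup Q]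

/-- Bottom row (dual), exactness at `Hom(Extˢ(P, X₂), Q)`. [cite: MilneADT2006, I (1.9.1)] -/
theorem exact_dual_g_f (hQ : Module.Baer ℤ Q) (P : 𝒞) (s : ℕ) :
    Function.Exact (AddMonoidHom.compHom' (P := Q) ((Ext.mk₀ S.g).postcomp P (add_zero s)))
      (AddMonoidHom.compHom' (P := Q) ((Ext.mk₀ S.f).postcomp P (add_zero s))) :=
  exact_compHom'_of_baer hQ _ _ (exact_postcomp_f_g hS P s)

/-- Bottom row (dual), exactness at `Hom(Extˢ(P, X₁), Q)`. [cite: MilneADT2006, I (1.9.1)] -/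
theorem exact_dual_f_extClass (hQ : Module.Baer ℤ Q) (P : 𝒞) {s' s : ℕ} (hs : s' + 1 = s) :
    Function.Exact (AddMonoidHom.compHom' (P := Q) ((Ext.mk₀ S.f).postcomp P (add_zero s)))
      (AddMonoidHom.compHom' (P := Q) (hS.extClass.postcomp P hs)) :=
  exact_compHom'_of_baer hQ _ _ (exact_postcomp_extClass_f hS P hs)

/-- Bottom row (dual), exactness at `Hom(Extˢ'(P, X₃), Q)`. [cite: MilneADT2006, I (1.9.1)] -/
theorem exact_dual_extClass_g (hQ : Module.Baer ℤ Q) (P : 𝒞) {s' s : ℕ} (hs : s' + 1 = s) :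
    Function.Exact (AddMonoidHom.compHom' (P := Q) (hS.extClass.postcomp P hs))
      (AddMonoidHom.compHom' (P := Q) ((Ext.mk₀ S.g).postcomp P (add_zero s'))) :=
  exact_compHom'_of_baer hQ _ _ (exact_postcomp_g_extClass hS P hs)

end Rows

/-! ## §2 The squares of the ladder commute -/

section Squares

variable {𝒞 : Type u} [Category.{v} 𝒞] [Abelian 𝒞] [HasExt.{w} 𝒞]
  {P C : 𝒞} {Q : Type w'} [AddCommGroup Q] (inv : Ext P C 2 →+ Q)

/-- Square over a morphism `φ : M ⟶ M'`: `(φ_*)^∨ ∘ α_{M'} = α_M ∘ φ^*`. [cite: Harari2020, §16.3] -/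
theorem compHom'_comp_adjointMap {M M' : 𝒞} (φ : M ⟶ M') {r s : ℕ} (h : s + r = 2) :
    (AddMonoidHom.compHom' (P := Q) ((Ext.mk₀ φ).postcomp P (add_zero s))).comp (adjointMap inv M' h) =
      (adjointMap inv M h).comp ((Ext.mk₀ φ).precomp C (zero_add r)) := by
  ext x y
  exact (pairing_mk₀_comp inv φ h x y).symm

/-- Square over the connecting maps: `δ^∨ ∘ α_{X₁} = α_{X₃} ∘ δ`. [cite: Harari2020, §16.3] -/
theorem compHom'_comp_adjointMap_extClass {S : ShortComplex 𝒞} (hS : S.ShortExact)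
    {r s r' s' : ℕ} (h : s + r = 2) (hr : 1 + r = r') (hs : s' + 1 = s) (h' : s' + r' = 2) :
    (AddMonoidHom.compHom' (P := Q) (hS.extClass.postcomp P hs)).comp (adjointMap inv S.X₁ h) =
      (adjointMap inv S.X₃ h').comp (hS.extClass.precomp C hr) := by
  ext x y
  exact (pairing_extClass_comp inv hS hr hs h' h x y).symm

end Squares

/-! ## §3 The four-lemma steps -/

section Ladder

variable {𝒞 : Type u} [Category.{v} 𝒞] [Abelian 𝒞] [HasExt.{w} 𝒞]
  {P C : 𝒞} {Q : Type w'} [AddCommGroup Q] (inv : Ext P C 2 →+ Q)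
  {S : ShortComplex 𝒞} (hS : S.ShortExact)

include hS

/-- **Injectivity transfer (Milne (1.9.1), Harari 16.21)**: for `0 → X₁ → X₂ → X₃ → 0` short exact
and bidegrees `s + r = 2`, `r' = r + 1`, `s' + 1 = s`: if `α^r(X₃)` is surjective, `α^r(X₂)` is
injective and `α^{r'}(X₃)` is injective, then `α^r(X₁)` is injective (`Q` injective).
[cite: MilneADT2006, I Theorem 1.8 (proof, (1.9.1))][cite: Harari2020, §16.3 Theorem 16.21] -/
theorem adjointInjective_of_ladder (hQ : Module.Baer ℤ Q) {r s r' s' : ℕ} (h : s + r = 2)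
    (hr : 1 + r = r') (hs : s' + 1 = s) (h' : s' + r' = 2)
    (h₃ : AdjointSurjective inv S.X₃ h) (h₂ : AdjointInjective inv S.X₂ h)
    (h₃' : AdjointInjective inv S.X₃ h') : AdjointInjective inv S.X₁ h :=
  AddMonoidHom.injective_of_surjective_of_injective_of_injective
    ((Ext.mk₀ S.g).precomp C (zero_add r)) ((Ext.mk₀ S.f).precomp C (zero_add r))
    (hS.extClass.precomp C hr)
    (AddMonoidHom.compHom' (P := Q) ((Ext.mk₀ S.g).postcomp P (add_zero s)))
    (AddMonoidHom.compHom' (P := Q) ((Ext.mk₀ S.f).postcomp P (add_zero s)))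
    (AddMonoidHom.compHom' (P := Q) (hS.extClass.postcomp P hs))
    (adjointMap inv S.X₃ h) (adjointMap inv S.X₂ h) (adjointMap inv S.X₁ h) (adjointMap inv S.X₃ h')
    (compHom'_comp_adjointMap inv S.g h) (compHom'_comp_adjointMap inv S.f h)
    (compHom'_comp_adjointMap_extClass inv hS h hr hs h')
    (exact_precomp_g_f hS C r) (exact_precomp_f_extClass hS C hr) (exact_dual_g_f hS hQ P s) h₃ h₂ h₃'

/-- **Surjectivity transfer (Milne (1.9.1), Harari 16.21)**: if `α^r(X₂)` is surjective,
`α^{r'}(X₃)` is surjective and `α^{r'}(X₂)` is injective, then `α^r(X₁)` is surjective.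
[cite: MilneADT2006, I Theorem 1.8 (proof, (1.9.1))][cite: Harari2020, §16.3 Theorem 16.21] -/
theorem adjointSurjective_of_ladder (hQ : Module.Baer ℤ Q) {r s r' s' : ℕ} (h : s + r = 2)
    (hr : 1 + r = r') (hs : s' + 1 = s) (h' : s' + r' = 2)
    (h₂ : AdjointSurjective inv S.X₂ h) (h₃' : AdjointSurjective inv S.X₃ h')
    (h₂' : AdjointInjective inv S.X₂ h') : AdjointSurjective inv S.X₁ h :=
  AddMonoidHom.surjective_of_surjective_of_surjective_of_injective
    ((Ext.mk₀ S.f).precomp C (zero_add r)) (hS.extClass.precomp C hr)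
    ((Ext.mk₀ S.g).precomp C (zero_add r'))
    (AddMonoidHom.compHom' (P := Q) ((Ext.mk₀ S.f).postcomp P (add_zero s)))
    (AddMonoidHom.compHom' (P := Q) (hS.extClass.postcomp P hs))
    (AddMonoidHom.compHom' (P := Q) ((Ext.mk₀ S.g).postcomp P (add_zero s')))
    (adjointMap inv S.X₂ h) (adjointMap inv S.X₁ h) (adjointMap inv S.X₃ h') (adjointMap inv S.X₂ h')
    (compHom'_comp_adjointMap inv S.f h) (compHom'_comp_adjointMap_extClass inv hS h hr hs h')
    (compHom'_comp_adjointMap inv S.g h')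
    (exact_precomp_extClass_g hS C hr) (exact_dual_f_extClass hS hQ P hs)
    (exact_dual_extClass_g hS hQ P hs) h₂ h₃' h₂'

/-- **Edge `r = 2`, injectivity**: if `α²(X₃)` is surjective, `α²(X₂)` is injective and
`Ext³(X₃, C) = 0`, then `α²(X₁)` is injective (the dual row has `Hom(Ext⁻¹, Q) = 0` in the fourth
place; `Ext³(X₃, C) = 0` makes `f^* : Ext²(X₂, C) → Ext²(X₁, C)` onto).
[cite: MilneADT2006, I Theorem 1.8 (proof, (1.9.1))][cite: Harari2020, §16.3 Theorem 16.21] -/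
theorem adjointInjective_two_of_ladder (hQ : Module.Baer ℤ Q) {r s : ℕ} (h : s + r = 2) (hs0 : s = 0)
    (h₃ : AdjointSurjective inv S.X₃ h) (h₂ : AdjointInjective inv S.X₂ h)
    (h₃' : ∀ x : Ext S.X₃ C (r + 1), x = 0) : AdjointInjective inv S.X₁ h := by
  subst hs0
  have hf : Function.Surjective ((Ext.mk₀ S.f).precomp C (zero_add r)) := fun x =>
    Ext.contravariant_sequence_exact₁ (hS := hS) (Y := C) x (add_comm 1 r) (h₃' _)
  exact AddMonoidHom.injective_of_surjective_of_injective_of_right_exact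
    ((Ext.mk₀ S.g).precomp C (zero_add r)) ((Ext.mk₀ S.f).precomp C (zero_add r))
    (AddMonoidHom.compHom' (P := Q) ((Ext.mk₀ S.g).postcomp P (add_zero 0)))
    (AddMonoidHom.compHom' (P := Q) ((Ext.mk₀ S.f).postcomp P (add_zero 0)))
    (adjointMap inv S.X₃ h) (adjointMap inv S.X₂ h) (adjointMap inv S.X₁ h)
    (compHom'_comp_adjointMap inv S.g h) (compHom'_comp_adjointMap inv S.f h)
    (exact_precomp_g_f hS C r) (exact_dual_g_f hS hQ P 0) h₃ h₂ hf

/-- **Edge `r = 2`, surjectivity**: if `α²(X₂)` is surjective then `α²(X₁)` is surjective (in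
bottom degree `0`, `f_* : Hom(P, X₁) → Hom(P, X₂)` is injective, so its `Q`-dual is onto).
[cite: MilneADT2006, I Theorem 1.8 (proof, (1.9.1))][cite: Harari2020, §16.3 Theorem 16.21] -/
theorem adjointSurjective_two_of_ladder (hQ : Module.Baer ℤ Q) {r s : ℕ} (h : s + r = 2) (hs0 : s = 0)
    (h₂ : AdjointSurjective inv S.X₂ h) : AdjointSurjective inv S.X₁ h := by
  subst hs0
  haveI := hS.mono_f
  intro Φ
  obtain ⟨Ψ, hΨ⟩ := compHom'_surjective_of_injective_of_baer hQ ((Ext.mk₀ S.f).postcomp P (add_zero 0))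
    (Ext.postcomp_mk₀_injective_of_mono P S.f) Φ
  obtain ⟨x₂, rfl⟩ := h₂ Ψ
  refine ⟨(Ext.mk₀ S.f).comp x₂ (zero_add r), ?_⟩
  rw [← hΨ, adjointMap_mk₀_comp]
  rfl

/-- **Rows `r ≥ 3` (where "`α^r` bijective" means `Extʳ(–, C) = 0`), middle term**:
`Extʳ(X₂, C) = 0` and `Extʳ⁺¹(X₃, C) = 0` imply `Extʳ(X₁, C) = 0`.
[cite: MilneADT2006, I Theorem 1.8 (proof)][cite: Harari2020, §16.3 Lemma 16.19] -/
theorem ext_eq_zero_of_ladder₁ (C : 𝒞) {r r' : ℕ} (hr : 1 + r = r')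
    (h₂ : ∀ x : Ext S.X₂ C r, x = 0) (h₃ : ∀ x : Ext S.X₃ C r', x = 0) (x : Ext S.X₁ C r) : x = 0 := by
  obtain ⟨x₂, rfl⟩ := Ext.contravariant_sequence_exact₁ (hS := hS) (Y := C) x hr (h₃ _)
  rw [h₂ x₂, Ext.comp_zero]

/-- **Rows `r ≥ 3`, third term (Lemma 1.9's resolution step `0 → M₁ → M₀ → M → 0`)**:
`Extʳ(X₁, C) = 0` and `Extʳ⁺¹(X₂, C) = 0` imply `Extʳ⁺¹(X₃, C) = 0`.
[cite: MilneADT2006, I Lemma 1.9 (proof)][cite: Harari2020, §16.3 Lemma 16.19] -/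
theorem ext_eq_zero_of_ladder₃ (C : 𝒞) {r r' : ℕ} (hr : 1 + r = r')
    (h₁ : ∀ x : Ext S.X₁ C r, x = 0) (h₂ : ∀ x : Ext S.X₂ C r', x = 0) (x : Ext S.X₃ C r') : x = 0 := by
  obtain ⟨x₁, rfl⟩ := Ext.contravariant_sequence_exact₃ (hS := hS) (Y := C) x
    (by rw [h₂ ((Ext.mk₀ S.g).comp x (zero_add r'))]) hr
  rw [h₁ x₁, Ext.comp_zero]

/-- **Rows `r ≥ 3`, second term**: `Extʳ(X₃, C) = 0` and `Extʳ(X₁, C) = 0` imply `Extʳ(X₂, C) = 0`.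
[cite: MilneADT2006, I Theorem 1.8 (proof)][cite: Harari2020, §16.3 Lemma 16.19] -/
theorem ext_eq_zero_of_ladder₂ (C : 𝒞) (r : ℕ)
    (h₃ : ∀ x : Ext S.X₃ C r, x = 0) (h₁ : ∀ x : Ext S.X₁ C r, x = 0) (x : Ext S.X₂ C r) : x = 0 := by
  obtain ⟨x₃, rfl⟩ := Ext.contravariant_sequence_exact₂ (hS := hS) (Y := C) x (h₁ _)
  rw [h₃ x₃, Ext.comp_zero]

end Ladder

/-! ## §4 The other positions of the five lemma (middle term `X₂`, quotient `X₃`)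

Appended (door-c4 g15): the four-lemma steps concluding about `α(X₂)` and `α(X₃)`, used for split
sequences / the dévissage of trivial modules (`0 → ℤ → M → M/ℤ → 0`) and for `0 → ℤ → ℤ → ℤ/m → 0`. -/

section LadderOther

variable {𝒞 : Type u} [Category.{v} 𝒞] [Abelian 𝒞] [HasExt.{w} 𝒞]
  {P C : 𝒞} {Q : Type w'} [AddCommGroup Q] (inv : Ext P C 2 →+ Q)
  {S : ShortComplex 𝒞} (hS : S.ShortExact)

include hS

/-- **Injectivity at the middle term**: with bidegrees `s₀ + r₀ = 2`, `1 + r₀ = r`, `s + 1 = s₀`,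
`s + r = 2`: if `α^{r₀}(X₁)` is surjective, `α^r(X₃)` injective and `α^r(X₁)` injective, then `α^r(X₂)`
is injective. [cite: MilneADT2006, I Theorem 1.8 (proof, (1.9.1))][cite: Harari2020, §16.3 Theorem 16.21] -/
theorem adjointInjective₂_of_ladder (hQ : Module.Baer ℤ Q) {r₀ s₀ r s : ℕ} (h₀ : s₀ + r₀ = 2)
    (hr : 1 + r₀ = r) (hs : s + 1 = s₀) (h : s + r = 2)
    (h₁ : AdjointSurjective inv S.X₁ h₀) (h₃ : AdjointInjective inv S.X₃ h)
    (h₁' : AdjointInjective inv S.X₁ h) : AdjointInjective inv S.X₂ h :=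
  AddMonoidHom.injective_of_surjective_of_injective_of_injective
    (hS.extClass.precomp C hr) ((Ext.mk₀ S.g).precomp C (zero_add r)) ((Ext.mk₀ S.f).precomp C (zero_add r))
    (AddMonoidHom.compHom' (P := Q) (hS.extClass.postcomp P hs))
    (AddMonoidHom.compHom' (P := Q) ((Ext.mk₀ S.g).postcomp P (add_zero s)))
    (AddMonoidHom.compHom' (P := Q) ((Ext.mk₀ S.f).postcomp P (add_zero s)))
    (adjointMap inv S.X₁ h₀) (adjointMap inv S.X₃ h) (adjointMap inv S.X₂ h) (adjointMap inv S.X₁ h)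
    (compHom'_comp_adjointMap_extClass inv hS h₀ hr hs h)
    (compHom'_comp_adjointMap inv S.g h) (compHom'_comp_adjointMap inv S.f h)
    (exact_precomp_extClass_g hS C hr) (exact_precomp_g_f hS C r) (exact_dual_extClass_g hS hQ P hs)
    h₁ h₃ h₁'

/-- **Surjectivity at the middle term**: with `s + r = 2`, `1 + r = r'`, `s' + 1 = s`, `s' + r' = 2`:
if `α^r(X₃)` and `α^r(X₁)` are surjective and `α^{r'}(X₃)` is injective, then `α^r(X₂)` is surjective.
[cite: MilneADT2006, I Theorem 1.8 (proof, (1.9.1))][cite: Harari2020, §16.3 Theorem 16.21] -/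
theorem adjointSurjective₂_of_ladder (hQ : Module.Baer ℤ Q) {r s r' s' : ℕ} (h : s + r = 2)
    (hr : 1 + r = r') (hs : s' + 1 = s) (h' : s' + r' = 2)
    (h₃ : AdjointSurjective inv S.X₃ h) (h₁ : AdjointSurjective inv S.X₁ h)
    (h₃' : AdjointInjective inv S.X₃ h') : AdjointSurjective inv S.X₂ h :=
  AddMonoidHom.surjective_of_surjective_of_surjective_of_injective
    ((Ext.mk₀ S.g).precomp C (zero_add r)) ((Ext.mk₀ S.f).precomp C (zero_add r))
    (hS.extClass.precomp C hr)
    (AddMonoidHom.compHom' (P := Q) ((Ext.mk₀ S.g).postcomp P (add_zero s)))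
    (AddMonoidHom.compHom' (P := Q) ((Ext.mk₀ S.f).postcomp P (add_zero s)))
    (AddMonoidHom.compHom' (P := Q) (hS.extClass.postcomp P hs))
    (adjointMap inv S.X₃ h) (adjointMap inv S.X₂ h) (adjointMap inv S.X₁ h) (adjointMap inv S.X₃ h')
    (compHom'_comp_adjointMap inv S.g h) (compHom'_comp_adjointMap inv S.f h)
    (compHom'_comp_adjointMap_extClass inv hS h hr hs h')
    (exact_precomp_f_extClass hS C hr) (exact_dual_g_f hS hQ P s) (exact_dual_f_extClass hS hQ P hs)
    h₃ h₁ h₃'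

/-- **Injectivity at the quotient**: with `s + r = 2`, `1 + r = r'`, `s' + 1 = s`, `s' + r' = 2`:
if `α^r(X₂)` is surjective, `α^r(X₁)` injective and `α^{r'}(X₂)` injective, then `α^{r'}(X₃)` is injective.
[cite: MilneADT2006, I Theorem 1.8 (proof, (1.9.1))][cite: Harari2020, §16.3 Theorem 16.21] -/
theorem adjointInjective₃_of_ladder (hQ : Module.Baer ℤ Q) {r s r' s' : ℕ} (h : s + r = 2)
    (hr : 1 + r = r') (hs : s' + 1 = s) (h' : s' + r' = 2)
    (h₂ : AdjointSurjective inv S.X₂ h) (h₁ : AdjointInjective inv S.X₁ h)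
    (h₂' : AdjointInjective inv S.X₂ h') : AdjointInjective inv S.X₃ h' :=
  AddMonoidHom.injective_of_surjective_of_injective_of_injective
    ((Ext.mk₀ S.f).precomp C (zero_add r)) (hS.extClass.precomp C hr)
    ((Ext.mk₀ S.g).precomp C (zero_add r'))
    (AddMonoidHom.compHom' (P := Q) ((Ext.mk₀ S.f).postcomp P (add_zero s)))
    (AddMonoidHom.compHom' (P := Q) (hS.extClass.postcomp P hs))
    (AddMonoidHom.compHom' (P := Q) ((Ext.mk₀ S.g).postcomp P (add_zero s')))
    (adjointMap inv S.X₂ h) (adjointMap inv S.X₁ h) (adjointMap inv S.X₃ h') (adjointMap inv S.X₂ h')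
    (compHom'_comp_adjointMap inv S.f h) (compHom'_comp_adjointMap_extClass inv hS h hr hs h')
    (compHom'_comp_adjointMap inv S.g h')
    (exact_precomp_f_extClass hS C hr) (exact_precomp_extClass_g hS C hr)
    (exact_dual_f_extClass hS hQ P hs) h₂ h₁ h₂'

/-- **Surjectivity at the quotient**: with `s + r = 2`, `1 + r = r'`, `s' + 1 = s`, `s' + r' = 2`:
if `α^r(X₁)` and `α^{r'}(X₂)` are surjective and `α^{r'}(X₁)` is injective, then `α^{r'}(X₃)` is
surjective. [cite: MilneADT2006, I Theorem 1.8 (proof, (1.9.1))][cite: Harari2020, §16.3 Theorem 16.21] -/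
theorem adjointSurjective₃_of_ladder (hQ : Module.Baer ℤ Q) {r s r' s' : ℕ} (h : s + r = 2)
    (hr : 1 + r = r') (hs : s' + 1 = s) (h' : s' + r' = 2)
    (h₁ : AdjointSurjective inv S.X₁ h) (h₂' : AdjointSurjective inv S.X₂ h')
    (h₁' : AdjointInjective inv S.X₁ h') : AdjointSurjective inv S.X₃ h' :=
  AddMonoidHom.surjective_of_surjective_of_surjective_of_injective
    (hS.extClass.precomp C hr) ((Ext.mk₀ S.g).precomp C (zero_add r'))
    ((Ext.mk₀ S.f).precomp C (zero_add r'))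
    (AddMonoidHom.compHom' (P := Q) (hS.extClass.postcomp P hs))
    (AddMonoidHom.compHom' (P := Q) ((Ext.mk₀ S.g).postcomp P (add_zero s')))
    (AddMonoidHom.compHom' (P := Q) ((Ext.mk₀ S.f).postcomp P (add_zero s')))
    (adjointMap inv S.X₁ h) (adjointMap inv S.X₃ h') (adjointMap inv S.X₂ h') (adjointMap inv S.X₁ h')
    (compHom'_comp_adjointMap_extClass inv hS h hr hs h') (compHom'_comp_adjointMap inv S.g h')
    (compHom'_comp_adjointMap inv S.f h')
    (exact_precomp_g_f hS C r') (exact_dual_extClass_g hS hQ P hs) (exact_dual_g_f hS hQ P s')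
    h₁ h₂' h₁'

/-- **Edge `r = 2`, surjectivity at the middle term**: if `α²(X₃)` and `α²(X₁)` are surjective and
`Ext³(X₃, C) = 0`, then `α²(X₂)` is surjective (the dual row has `0` in the fourth place, and in bottom
degree `0` the dual of `f_*` is onto). [cite: MilneADT2006, I Theorem 1.8 (proof, (1.9.1))][cite: Harari2020, §16.3 Theorem 16.21] -/
theorem adjointSurjective₂_two_of_ladder (hQ : Module.Baer ℤ Q) {r s : ℕ} (h : s + r = 2) (hs0 : s = 0)
    (h₃ : AdjointSurjective inv S.X₃ h) (h₁ : AdjointSurjective inv S.X₁ h)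
    (h₃' : ∀ x : Ext S.X₃ C (r + 1), x = 0) : AdjointSurjective inv S.X₂ h := by
  subst hs0
  haveI := hS.mono_f
  have hdual : Function.Surjective
      (AddMonoidHom.compHom' (P := Q) ((Ext.mk₀ S.f).postcomp P (add_zero 0))) :=
    compHom'_surjective_of_injective_of_baer hQ _ (Ext.postcomp_mk₀_injective_of_mono P S.f)
  refine AddMonoidHom.surjective_of_surjective_of_surjective_of_injective
    ((Ext.mk₀ S.g).precomp C (zero_add r)) ((Ext.mk₀ S.f).precomp C (zero_add r))
    (hS.extClass.precomp C (add_comm 1 r))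
    (AddMonoidHom.compHom' (P := Q) ((Ext.mk₀ S.g).postcomp P (add_zero 0)))
    (AddMonoidHom.compHom' (P := Q) ((Ext.mk₀ S.f).postcomp P (add_zero 0)))
    (0 : (Ext P S.X₁ 0 →+ Q) →+ Unit)
    (adjointMap inv S.X₃ h) (adjointMap inv S.X₂ h) (adjointMap inv S.X₁ h)
    (0 : Ext S.X₃ C (r + 1) →+ Unit)
    (compHom'_comp_adjointMap inv S.g h) (compHom'_comp_adjointMap inv S.f h)
    (AddMonoidHom.ext fun _ => rfl)
    (exact_precomp_f_extClass hS C (add_comm 1 r)) (exact_dual_g_f hS hQ P 0) (fun Φ => ?_)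
    h₃ h₁ (fun x y _ => (h₃' x).trans (h₃' y).symm)
  simp only [AddMonoidHom.zero_apply, Set.mem_range, true_iff]
  exact hdual Φ

end LadderOther

end ExtDuality

end Literature.Algebra.Homology
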